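import Summits.QuantumFields.YangMills.Theorems.AlphaInputsT3ACv3OneBlockLiftKernelRows
import Summits.QuantumFields.YangMills.Theorems.AlphaInputsT3ACv3LinearLiftMatrixKernel
import HarnessLib

/-!
# `AlphaInputsT3ACv3OneBlockLiftMatrix` — (r1-ob) THE MATRIX ∕ CLM ∕ TWISTED PORT OF THE ONE-BLOCK KERNEL OF RECORD `obLift` (MAP #3 row M18): ✓ p600296
# `…v3LinearLiftMatrixKernel` (the ABSTRACT kernel port, every row stated once for a linear scalar kernel `T` under (E)∕(B)∕(C)) INSTANTIATED at `T := OneBlock.obLiftL F K k`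
# through ★alpha-2 g6's scalar rows of record `…v3OneBlockLiftKernelRows` — cell `ym3-torus`, width seat `ym-ust-19936-w3` (g3); def-free

WHY (cell `ym3-torus` 2026-08-28: ★★OWNER g25 03:01:17Z∕03:02:25Z «(r1-ob): KERNEL OF RECORD for the Newton route := ★alpha-2 g6's ONE-BLOCK exact lift `obLift`; matrix∕twist
port ★w3»; 03:34:10Z «scalar certificate rows of record: (E) `linAvgIter_obLiftL`, (B) `abs_obLift_le_local` (ρ = 1056∕Lᵏ, ONE-block support), (C) `abs_curlAt_obLift_le_local`
(ρ′ = 1728∕L^{2k}, three blocks) ⇒ M18 (port) + M19 (cert) are by-`exact` jobs now»).  The regional Newton theorem of record ★w4 g2's `NewtonLiftFramed.exists_exact_lift_regional_allL`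
(✓ p600658) and its window form (✓ p601499) take an `ℝ`-linear MATRIX kernel `R₀` with rows (`𝔰𝔲`-valuedness, `‖R₀u‖ ≤ (C_R∕Lᵏ)‖u‖`, framed approximate right inverse, curl in a gauge);
THIS FILE is the matrix side of that kernel for `obLift`:
* §1 the untwisted port `byEntry (obLiftL F K k)`: ★ `linAvgIterM_byEntry_obLiftL` (EXACTNESS `Q^{(k)} ∘ R = id` on `M_n(ℂ)`-valued one-forms), `byEntry_obLiftL_mem` (`𝔰𝔲`), the sup
  bound `norm_byEntry_obLiftL_le_local`∕`_le`∕`_le_norm` (ρ = 1056∕Lᵏ, read on the three coarse bonds of the block of `b₋` only), ONE-BLOCK LOCALITY `byEntry_obLiftL_congr_local`∕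
  `_eq_zero_of_local` (+ `iterBlockOf` letters), the curl row `norm_curlM_byEntry_obLiftL_le_local`∕`_le` (ρ′ = 1728∕L^{2k}, read on three blocks).
* §2 the CLM packaging `byEntryCLM (obLiftL F K k) (1056∕Lᵏ) …`: `avgCLM ∘ R = id` (κ = 0), ★ `‖T_avg‖·‖R‖ ≤ (d+1)·1056` k-UNIFORM, the curl row, `𝔰𝔲`-valuedness.
* §3 the twisted port `byEntryTw (obLiftL F K k) ψ` (frames `ψ b c′ : M_n(ℂ) →ₗ[ℝ] M_n(ℂ)`): `exists_linearMap_byEntryTw` (an `ℝ`-LINEAR MAP `R₀` with `R₀ u = byEntryTw T ψ u` EXISTS — the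
  `R₀` binder of (D), no definition), `byEntryTw_obLiftL_mem`, the sup bound for contractive frames (`_le_local`∕`_le`∕`_le_norm`: `‖R₀u‖ ≤ (1056∕Lᵏ)‖u‖`), ONE-BLOCK LOCALITY of the
  twisted port, ★★ the EXACTNESS DEFECT `norm_linAvgIterM_byEntryTw_obLiftL_sub_le` (`≤ 4224·θ·M` — k-FREE — for frames θ-close to `1` on the one-block support), ★★ the (r1-curl) twin
  `norm_curlM_byEntryTw_obLiftL_le` (`≤ (1728∕L^{2k})·M + 3·(1056∕Lᵏ)·θ′·M` for contractive frames θ′-frozen across the plaquette on the supports).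
HONEST FRAMING.  Instantiation by `exact` of kernel-checked tree lemmas (finite-dimensional real linear algebra); the gauge frames, their flatness∕oscillation letters and the START
are INPUTS elsewhere ((D-cert) M19, (S5)∕(S6)); (FL)∕`hLift`, the stub 2′χ `stub_laneRecordsV3Chi`, the crux `HistoryTailL` and any gap are NOT claimed; count-neutral helper
(`--supports stmt-QuantumFields-19936`); registry untouched.  YM₃ on the three-torus is rung R3 of the programme, NOT the Clay problem; nothing here is about d = 4, infinite
volume or a mass gap.

References: T. Bałaban, Commun. Math. Phys. 109 (1987) 249–301 [Balaban1987RG1] ((0.3) p.252, (0.4)+(0.11) p.253); Commun. Math. Phys. 102 (1985) 277–309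
[Balaban1985Variational] ((8) p.279); Commun. Math. Phys. 98 (1985) 17–51 [Balaban1985Averaging] ((9), (11) p.19; Prop. 4 (130)–(131) p.38).
-/

set_option autoImplicit false

noncomputable section

open scoped Matrix.Norms.L2Operator Classical

namespace Summit.QuantumFields.YangMills.Theorems.OneBlockLiftMatrix

open Literature.MathematicalPhysics.QuantumFieldTheory.Balaban1983to89
open Literature.MathematicalPhysics.QuantumFieldTheory.Balaban1983to89.T3ContinuumYM3Torus
open Literature.MathematicalPhysics.QuantumFieldTheory.Balaban1985CMP102.Setting
open Literature.MathematicalPhysics.QuantumFieldTheory.Balaban1983to89.B5Eq118OneStroke (iterBlockOf)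
open Summit.QuantumFields.Balaban3D.Carriers (coarsen)
open Summit.QuantumFields.YangMills.Theorems.AvgIterLocality (coarsen_eq_iterBlockOf)
open Summit.QuantumFields.YangMills.Theorems.AbelianEML (linAvgIter curlAt)
open Summit.QuantumFields.YangMills.Theorems.AbelianEML.OneBlock
open Summit.QuantumFields.YangMills.Theorems.LinearLiftMatrix

variable {F : T3Family} {K k : ℕ} {n : Type*}

/-! ## §1 The untwisted port `byEntry (obLiftL F K k)`: exactness, `𝔰𝔲`-valuedness, sup bound, one-block locality, curl row -/

section Untwisted

/-- **★ (E) EXACTNESS OF THE MATRIX PORT OF THE ONE-BLOCK KERNEL**: `linAvgIterM k (byEntry obLiftL A) = A` for every `M_n(ℂ)`-valued coarse one-form `A` (`k ≤ K`, `L^k ≥ 3`).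
[cite: Balaban1987RG1, (0.4)+(0.11) p.253] -/
theorem linAvgIterM_byEntry_obLiftL [Fintype n] [DecidableEq n] [Nonempty n] (hk : k ≤ K) (hn3 : 3 ≤ F.L ^ k) (A : PBond (F.P K) k → Matrix n n ℂ) :
    linAvgIterM k (byEntry (obLiftL F K k) A) = A :=
  linAvgIterM_byEntry_of_exact k (obLiftL F K k) (obLiftL_rowE hk hn3) A

/-- **`𝔰𝔲`-VALUEDNESS** (any `ℝ`-submodule `S` of `M_n(ℂ)`): `S`-valued data have `S`-valued port. [folklore] -/
theorem byEntry_obLiftL_mem (S : Submodule ℝ (Matrix n n ℂ)) {A : PBond (F.P K) k → Matrix n n ℂ} (hA : ∀ c, A c ∈ S) (b : PBond (F.P K) 0) :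
    byEntry (obLiftL F K k) A b ∈ S :=
  byEntry_mem' k (obLiftL F K k) S hA b

/-- **ONE-BLOCK LOCALITY**: the port at the finest bond `b` reads the data only on the (three) coarse bonds issuing from `coarsen k b₋` — two data agreeing there have the same port
at `b`. [cite: Balaban1987RG1, (0.3) p.252] -/
theorem byEntry_obLiftL_congr_local (hk : k ≤ K) (hn3 : 3 ≤ F.L ^ k) (A A' : PBond (F.P K) k → Matrix n n ℂ) (b : PBond (F.P K) 0)
    (h : ∀ c : PBond (F.P K) k, c.src = coarsen k b.src → A c = A' c) : byEntry (obLiftL F K k) A b = byEntry (obLiftL F K k) A' b :=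
  byEntry_congr_of_bound (obLiftL F K k) (fun c : PBond (F.P K) k => c.src = coarsen k b.src) b (fun f M hf => obLiftL_rowB_local hk hn3 f M b hf) A A' h

/-- **ONE-BLOCK LOCALITY, VANISHING FORM**: data vanishing on the coarse bonds issuing from `coarsen k b₋` have zero port at `b`. [cite: Balaban1987RG1, (0.3) p.252] -/
theorem byEntry_obLiftL_eq_zero_of_local (hk : k ≤ K) (hn3 : 3 ≤ F.L ^ k) (A : PBond (F.P K) k → Matrix n n ℂ) (b : PBond (F.P K) 0)
    (h : ∀ c : PBond (F.P K) k, c.src = coarsen k b.src → A c = 0) : byEntry (obLiftL F K k) A b = 0 :=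
  byEntry_eq_zero_of_bound (obLiftL F K k) (fun c : PBond (F.P K) k => c.src = coarsen k b.src) b (fun f M hf => obLiftL_rowB_local hk hn3 f M b hf) A h

/-- One-block locality in the (LL) engine's ∕ (D)'s `iterBlockOf` letters (`coarsen = iterBlockOf`). [cite: Balaban1987RG1, (0.3) p.252] -/
theorem byEntry_obLiftL_congr_local' (hk : k ≤ K) (hn3 : 3 ≤ F.L ^ k) (A A' : PBond (F.P K) k → Matrix n n ℂ) (b : PBond (F.P K) 0)
    (h : ∀ c : PBond (F.P K) k, c.src = iterBlockOf k b.src → A c = A' c) : byEntry (obLiftL F K k) A b = byEntry (obLiftL F K k) A' b :=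
  byEntry_obLiftL_congr_local hk hn3 A A' b fun c hc => h c (hc.trans (coarsen_eq_iterBlockOf k b.src))

/-- Vanishing form in `iterBlockOf` letters. [cite: Balaban1987RG1, (0.3) p.252] -/
theorem byEntry_obLiftL_eq_zero_of_local' (hk : k ≤ K) (hn3 : 3 ≤ F.L ^ k) (A : PBond (F.P K) k → Matrix n n ℂ) (b : PBond (F.P K) 0)
    (h : ∀ c : PBond (F.P K) k, c.src = iterBlockOf k b.src → A c = 0) : byEntry (obLiftL F K k) A b = 0 :=
  byEntry_obLiftL_eq_zero_of_local hk hn3 A b fun c hc => h c (hc.trans (coarsen_eq_iterBlockOf k b.src))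

variable [Fintype n] [DecidableEq n]

/-- **(B) THE SUP BOUND, LOCAL**: `‖byEntry obLiftL A (b)‖ ≤ (1056∕L^k)·M` from `‖A c‖ ≤ M` on the coarse bonds issuing from `coarsen k b₋` (same constant as the scalar row, no `|n|²`).
[cite: Balaban1987RG1, (0.4)+(0.11) p.253] -/
theorem norm_byEntry_obLiftL_le_local (hk : k ≤ K) (hn3 : 3 ≤ F.L ^ k) (A : PBond (F.P K) k → Matrix n n ℂ) (b : PBond (F.P K) 0) {M : ℝ} (hM : 0 ≤ M)
    (hA : ∀ c : PBond (F.P K) k, c.src = coarsen k b.src → ‖A c‖ ≤ M) : ‖byEntry (obLiftL F K k) A b‖ ≤ 1056 / (F.L : ℝ) ^ k * M :=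
  norm_byEntry_le_of_bound (obLiftL F K k) (fun c : PBond (F.P K) k => c.src = coarsen k b.src) b (fun f M' hf => obLiftL_rowB_local hk hn3 f M' b hf) A hM hA

/-- **(B) THE SUP BOUND, GLOBAL**: `‖A c‖ ≤ M` everywhere ⇒ `‖byEntry obLiftL A (b)‖ ≤ (1056∕L^k)·M`. [cite: Balaban1987RG1, (0.4)+(0.11) p.253] -/
theorem norm_byEntry_obLiftL_le (hk : k ≤ K) (hn3 : 3 ≤ F.L ^ k) (A : PBond (F.P K) k → Matrix n n ℂ) {M : ℝ} (hA : ∀ c, ‖A c‖ ≤ M) (b : PBond (F.P K) 0) :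
    ‖byEntry (obLiftL F K k) A b‖ ≤ 1056 / (F.L : ℝ) ^ k * M :=
  norm_byEntry_obLiftL_le_local hk hn3 A b ((norm_nonneg _).trans (hA ⟨coarsen k b.src, b.dir⟩)) fun c _ => hA c

/-- **(B) THE SUP BOUND, SUP-NORM FORM**: `‖byEntry obLiftL A‖ ≤ (1056∕L^k)·‖A‖`. [cite: Balaban1987RG1, (0.4)+(0.11) p.253] -/
theorem norm_byEntry_obLiftL_le_norm (hk : k ≤ K) (hn3 : 3 ≤ F.L ^ k) (A : PBond (F.P K) k → Matrix n n ℂ) :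
    ‖byEntry (obLiftL F K k) A‖ ≤ 1056 / (F.L : ℝ) ^ k * ‖A‖ :=
  (pi_norm_le_iff_of_nonneg (by positivity)).2 fun b => norm_byEntry_obLiftL_le hk hn3 A (fun c => norm_le_pi_norm A c) b

/-- **(C) THE CURL ROW, LOCAL**: `‖curlM (byEntry obLiftL A) x μ ν‖ ≤ (1728∕L^{2k})·M` from `‖A c‖ ≤ M` on the coarse bonds issuing from the three blocks `coarsen k x`, `coarsen k (x+e_μ)`,
`coarsen k (x+e_ν)` (`μ ≠ ν`). [cite: Balaban1985Variational, (8) p.279; Balaban1985Averaging, (9) p.19] -/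
theorem norm_curlM_byEntry_obLiftL_le_local (hk : k ≤ K) (hn3 : 3 ≤ F.L ^ k) (A : PBond (F.P K) k → Matrix n n ℂ) (x : Site (F.P K) 0) {μ ν : Fin 3} (hμν : μ ≠ ν)
    {M : ℝ} (hM : 0 ≤ M) (hA : ∀ c : PBond (F.P K) k, (c.src = coarsen k x ∨ c.src = coarsen k (x.shift μ) ∨ c.src = coarsen k (x.shift ν)) → ‖A c‖ ≤ M) :
    ‖curlM (byEntry (obLiftL F K k) A) x μ ν‖ ≤ 1728 / ((F.L : ℝ) ^ k) ^ 2 * M :=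
  norm_curlM_byEntry_le_of_bound k (obLiftL F K k) (fun c : PBond (F.P K) k => c.src = coarsen k x ∨ c.src = coarsen k (x.shift μ) ∨ c.src = coarsen k (x.shift ν)) x μ ν
    (fun f M' hf => obLiftL_rowC_local hk hn3 f M' x μ ν hμν hf) A hM hA

/-- **(C) THE CURL ROW, GLOBAL**: `‖A c‖ ≤ M` everywhere ⇒ `‖curlM (byEntry obLiftL A) x μ ν‖ ≤ (1728∕L^{2k})·M` (`μ ≠ ν`). [cite: Balaban1985Variational, (8) p.279] -/
theorem norm_curlM_byEntry_obLiftL_le (hk : k ≤ K) (hn3 : 3 ≤ F.L ^ k) (A : PBond (F.P K) k → Matrix n n ℂ) {M : ℝ} (hA : ∀ c, ‖A c‖ ≤ M) (x : Site (F.P K) 0) {μ ν : Fin 3}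
    (hμν : μ ≠ ν) : ‖curlM (byEntry (obLiftL F K k) A) x μ ν‖ ≤ 1728 / ((F.L : ℝ) ^ k) ^ 2 * M :=
  norm_curlM_byEntry_obLiftL_le_local hk hn3 A x hμν ((norm_nonneg _).trans (hA ⟨coarsen k x, μ⟩)) fun c _ => hA c

/-- **(C) THE CURL ROW, SUP-NORM FORM**: `‖curlM (byEntry obLiftL A) x μ ν‖ ≤ (1728∕L^{2k})·‖A‖` (`μ ≠ ν`). [cite: Balaban1985Variational, (8) p.279] -/
theorem norm_curlM_byEntry_obLiftL_le_norm (hk : k ≤ K) (hn3 : 3 ≤ F.L ^ k) (A : PBond (F.P K) k → Matrix n n ℂ) (x : Site (F.P K) 0) {μ ν : Fin 3} (hμν : μ ≠ ν) :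
    ‖curlM (byEntry (obLiftL F K k) A) x μ ν‖ ≤ 1728 / ((F.L : ℝ) ^ k) ^ 2 * ‖A‖ :=
  norm_curlM_byEntry_obLiftL_le hk hn3 A (fun c => norm_le_pi_norm A c) x hμν

end Untwisted

/-! ## §2 The CLM packaging `R = byEntryCLM (obLiftL F K k) (1056∕L^k) …` for the sup norms: the Newton pair `(T_avg, R)` -/

section CLM

variable [Fintype n] [DecidableEq n]

/-- The sup constant of the one-block kernel is non-negative. [folklore] -/
theorem rho_nonneg : (0 : ℝ) ≤ 1056 / (F.L : ℝ) ^ k := by positivity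

/-- **`T_avg ∘ R = id`** for the CLM-packaged one-block kernel. [cite: Balaban1987RG1, (0.4)+(0.11) p.253] -/
theorem avgCLM_byEntryCLM_obLiftL [Nonempty n] (hk : k ≤ K) (hn3 : 3 ≤ F.L ^ k) (u : PBond (F.P K) k → Matrix n n ℂ) :
    avgCLM (F.P K) k (byEntryCLM (obLiftL F K k) (1056 / (F.L : ℝ) ^ k) rho_nonneg (obLiftL_rowB hk hn3) u) = u :=
  avgCLM_byEntryCLM_of_exact k (obLiftL F K k) _ rho_nonneg (obLiftL_rowB hk hn3) (obLiftL_rowE hk hn3) u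

/-- The approximate-right-inverse row with `κ = 0`: `‖T_avg (R u) − u‖ ≤ 0·‖u‖`. [folklore] -/
theorem norm_avgCLM_byEntryCLM_obLiftL_sub_le [Nonempty n] (hk : k ≤ K) (hn3 : 3 ≤ F.L ^ k) (u : PBond (F.P K) k → Matrix n n ℂ) :
    ‖avgCLM (F.P K) k (byEntryCLM (obLiftL F K k) (1056 / (F.L : ℝ) ^ k) rho_nonneg (obLiftL_rowB hk hn3) u) - u‖ ≤ 0 * ‖u‖ :=
  norm_avgCLM_byEntryCLM_sub_le k (obLiftL F K k) _ rho_nonneg (obLiftL_rowB hk hn3) (obLiftL_rowE hk hn3) u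

/-- **★ `‖T_avg‖·‖R‖ ≤ (d+1)·1056 = 4224` — k-UNIFORM** (the one-block kernel's `ρ = 1056∕L^k` against `‖Q^{(k)}‖ ≤ (d+1)L^k`).
[cite: Balaban1987RG1, (0.4)+(0.11) p.253; Balaban1985Averaging, Prop. 4 (130)–(131) p.38] -/
theorem norm_avgCLM_mul_norm_byEntryCLM_obLiftL_le (hk : k ≤ K) (hn3 : 3 ≤ F.L ^ k) :
    ‖(avgCLM (F.P K) k : (PBond (F.P K) 0 → Matrix n n ℂ) →L[ℝ] (PBond (F.P K) k → Matrix n n ℂ))‖ *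
        ‖(byEntryCLM (obLiftL F K k) (1056 / (F.L : ℝ) ^ k) rho_nonneg (obLiftL_rowB hk hn3) : (PBond (F.P K) k → Matrix n n ℂ) →L[ℝ] (PBond (F.P K) 0 → Matrix n n ℂ))‖ ≤
      4224 := by
  have h : ‖(avgCLM (F.P K) k : (PBond (F.P K) 0 → Matrix n n ℂ) →L[ℝ] (PBond (F.P K) k → Matrix n n ℂ))‖ *
        ‖(byEntryCLM (obLiftL F K k) (1056 / (F.L : ℝ) ^ k) rho_nonneg (obLiftL_rowB hk hn3) : (PBond (F.P K) k → Matrix n n ℂ) →L[ℝ] (PBond (F.P K) 0 → Matrix n n ℂ))‖ ≤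
      (((3 : ℕ) : ℝ) + 1) * 1056 :=
    norm_avgCLM_mul_norm_byEntryCLM_le_of_eq k (obLiftL F K k) _ rho_nonneg (obLiftL_rowB hk hn3) rfl
  refine h.trans ?_
  norm_num

/-- **THE CURL ROW OF THE PACKAGED KERNEL**: `‖curlM (R u) x μ ν‖ ≤ (1728∕L^{2k})·‖u‖` (`μ ≠ ν`). [cite: Balaban1985Variational, (8) p.279; Balaban1985Averaging, (9) p.19] -/
theorem norm_curlM_byEntryCLM_obLiftL_le (hk : k ≤ K) (hn3 : 3 ≤ F.L ^ k) (u : PBond (F.P K) k → Matrix n n ℂ) (x : Site (F.P K) 0) {μ ν : Fin 3} (hμν : μ ≠ ν) :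
    ‖curlM (byEntryCLM (obLiftL F K k) (1056 / (F.L : ℝ) ^ k) rho_nonneg (obLiftL_rowB hk hn3) u) x μ ν‖ ≤ 1728 / ((F.L : ℝ) ^ k) ^ 2 * ‖u‖ :=
  norm_curlM_byEntryCLM_le k (obLiftL F K k) _ rho_nonneg (obLiftL_rowB hk hn3) (fun f M y μ' ν' hμν' hf => obLiftL_rowC hk hn3 f M y μ' ν' hμν' hf) u x hμν

/-- `𝔰𝔲`-valuedness of the packaged kernel. [folklore] -/
theorem byEntryCLM_obLiftL_mem (hk : k ≤ K) (hn3 : 3 ≤ F.L ^ k) (S : Submodule ℝ (Matrix n n ℂ)) {u : PBond (F.P K) k → Matrix n n ℂ} (hu : ∀ c, u c ∈ S)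
    (b : PBond (F.P K) 0) : byEntryCLM (obLiftL F K k) (1056 / (F.L : ℝ) ^ k) rho_nonneg (obLiftL_rowB hk hn3) u b ∈ S :=
  byEntryCLM_mem k (obLiftL F K k) _ rho_nonneg (obLiftL_rowB hk hn3) S hu b

end CLM

/-! ## §3 The twisted port `byEntryTw (obLiftL F K k) ψ`: linear packaging, `𝔰𝔲`-valuedness, sup bound, locality, exactness defect, the (r1-curl) row -/

section Twist

/-- **THE TWISTED PORT IS AN `ℝ`-LINEAR MAP OF THE DATA** (any linear scalar kernel `T`, any frames `ψ`): there is `R₀ : (ι → M_n(ℂ)) →ₗ[ℝ] (κ → M_n(ℂ))` with `R₀ u = byEntryTw T ψ u` —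
the `R₀` binder of `NewtonLiftFramed.exists_exact_lift_regional_allL` (consumers `obtain ⟨R₀, hR₀⟩`; no definition). [folklore] -/
theorem exists_linearMap_byEntryTw {ι κ : Type*} [Fintype ι] (T : (ι → ℝ) →ₗ[ℝ] (κ → ℝ)) (ψ : κ → ι → Matrix n n ℂ →ₗ[ℝ] Matrix n n ℂ) :
    ∃ R₀ : (ι → Matrix n n ℂ) →ₗ[ℝ] (κ → Matrix n n ℂ), ∀ u, R₀ u = byEntryTw T ψ u := by
  refine ⟨{ toFun := byEntryTw T ψ, map_add' := fun u v => ?_, map_smul' := fun r u => ?_ }, fun u => rfl⟩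
  · funext b
    simp only [byEntryTw_def, Pi.add_apply, map_add, smul_add, Finset.sum_add_distrib]
  · funext b
    simp only [byEntryTw_def, Pi.smul_apply, LinearMap.map_smul, RingHom.id_apply, Finset.smul_sum, smul_comm (r : ℝ)]

/-- **`𝔰𝔲`-VALUEDNESS OF THE TWISTED PORT**: if every frame `ψ b c` maps the `ℝ`-submodule `S` into itself (e.g. `Ad g` on `𝔰𝔲(n)`) and the data are `S`-valued, so is
`byEntryTw obLiftL ψ u (b)`. [folklore] -/
theorem byEntryTw_obLiftL_mem (ψ : PBond (F.P K) 0 → PBond (F.P K) k → Matrix n n ℂ →ₗ[ℝ] Matrix n n ℂ) (S : Submodule ℝ (Matrix n n ℂ))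
    (hψ : ∀ b c X, X ∈ S → ψ b c X ∈ S) {u : PBond (F.P K) k → Matrix n n ℂ} (hu : ∀ c, u c ∈ S) (b : PBond (F.P K) 0) : byEntryTw (obLiftL F K k) ψ u b ∈ S :=
  byEntryTw_mem (obLiftL F K k) ψ S hψ hu b

/-- **ONE-BLOCK LOCALITY OF THE TWISTED PORT**: `byEntryTw obLiftL ψ u (b)` reads the data (and the frames) only on the coarse bonds issuing from `coarsen k b₋`.
[cite: Balaban1987RG1, (0.3) p.252] -/
theorem byEntryTw_obLiftL_congr_local (hk : k ≤ K) (hn3 : 3 ≤ F.L ^ k) (ψ ψ' : PBond (F.P K) 0 → PBond (F.P K) k → Matrix n n ℂ →ₗ[ℝ] Matrix n n ℂ)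
    (u u' : PBond (F.P K) k → Matrix n n ℂ) (b : PBond (F.P K) 0) (hψ : ∀ c : PBond (F.P K) k, c.src = coarsen k b.src → ψ b c = ψ' b c)
    (hu : ∀ c : PBond (F.P K) k, c.src = coarsen k b.src → u c = u' c) : byEntryTw (obLiftL F K k) ψ u b = byEntryTw (obLiftL F K k) ψ' u' b := by
  rw [byEntryTw_def, byEntryTw_def]
  refine Finset.sum_congr rfl fun c _ => ?_
  by_cases hc : c.src = coarsen k b.src
  · rw [hψ c hc, hu c hc]
  · rw [kernel_eq_zero_of_bound (obLiftL F K k) (fun c : PBond (F.P K) k => c.src = coarsen k b.src) b (fun f M hf => obLiftL_rowB_local hk hn3 f M b hf) hc,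
      zero_smul, zero_smul]

/-- Vanishing form: data vanishing on the coarse bonds issuing from `coarsen k b₋` have zero twisted port at `b`. [cite: Balaban1987RG1, (0.3) p.252] -/
theorem byEntryTw_obLiftL_eq_zero_of_local (hk : k ≤ K) (hn3 : 3 ≤ F.L ^ k) (ψ : PBond (F.P K) 0 → PBond (F.P K) k → Matrix n n ℂ →ₗ[ℝ] Matrix n n ℂ)
    (u : PBond (F.P K) k → Matrix n n ℂ) (b : PBond (F.P K) 0) (hu : ∀ c : PBond (F.P K) k, c.src = coarsen k b.src → u c = 0) :
    byEntryTw (obLiftL F K k) ψ u b = 0 := by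
  rw [byEntryTw_obLiftL_congr_local hk hn3 ψ ψ u (fun _ => 0) b (fun _ _ => rfl) hu, byEntryTw_def]
  simp

variable [Fintype n] [DecidableEq n]

/-- **(B) THE SUP BOUND OF THE TWISTED PORT, LOCAL**, for frames CONTRACTIVE on the support (`‖ψ b c X‖ ≤ ‖X‖`, e.g. the gauge frames `Ad g`): `‖byEntryTw obLiftL ψ u (b)‖ ≤ (1056∕L^k)·M`
from `‖u c‖ ≤ M` on the coarse bonds issuing from `coarsen k b₋`. [cite: Balaban1987RG1, (0.4)+(0.11) p.253] -/
theorem norm_byEntryTw_obLiftL_le_local (hk : k ≤ K) (hn3 : 3 ≤ F.L ^ k) (ψ : PBond (F.P K) 0 → PBond (F.P K) k → Matrix n n ℂ →ₗ[ℝ] Matrix n n ℂ) (b : PBond (F.P K) 0)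
    (hψ : ∀ c : PBond (F.P K) k, c.src = coarsen k b.src → ∀ X, ‖ψ b c X‖ ≤ ‖X‖) (u : PBond (F.P K) k → Matrix n n ℂ) {M : ℝ} (hM : 0 ≤ M)
    (hu : ∀ c : PBond (F.P K) k, c.src = coarsen k b.src → ‖u c‖ ≤ M) : ‖byEntryTw (obLiftL F K k) ψ u b‖ ≤ 1056 / (F.L : ℝ) ^ k * M :=
  norm_byEntryTw_le_of_bound (obLiftL F K k) ψ (fun c : PBond (F.P K) k => c.src = coarsen k b.src) b (fun f M' hf => obLiftL_rowB_local hk hn3 f M' b hf) hψ u hM hu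

/-- **(B) THE SUP BOUND OF THE TWISTED PORT, GLOBAL**, for contractive frames: `‖u c‖ ≤ M` everywhere ⇒ `‖byEntryTw obLiftL ψ u (b)‖ ≤ (1056∕L^k)·M`.
[cite: Balaban1987RG1, (0.4)+(0.11) p.253] -/
theorem norm_byEntryTw_obLiftL_le (hk : k ≤ K) (hn3 : 3 ≤ F.L ^ k) (ψ : PBond (F.P K) 0 → PBond (F.P K) k → Matrix n n ℂ →ₗ[ℝ] Matrix n n ℂ)
    (hψ : ∀ b c X, ‖ψ b c X‖ ≤ ‖X‖) (u : PBond (F.P K) k → Matrix n n ℂ) {M : ℝ} (hu : ∀ c, ‖u c‖ ≤ M) (b : PBond (F.P K) 0) :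
    ‖byEntryTw (obLiftL F K k) ψ u b‖ ≤ 1056 / (F.L : ℝ) ^ k * M :=
  norm_byEntryTw_obLiftL_le_local hk hn3 ψ b (fun c _ X => hψ b c X) u ((norm_nonneg _).trans (hu ⟨coarsen k b.src, b.dir⟩)) fun c _ => hu c

/-- **(B) THE SUP BOUND OF THE TWISTED PORT, SUP-NORM FORM** (row (iii) of (D): `‖R₀ u‖ ≤ (C_R∕L^k)‖u‖` with `C_R = 1056`), for contractive frames.
[cite: Balaban1987RG1, (0.4)+(0.11) p.253] -/
theorem norm_byEntryTw_obLiftL_le_norm (hk : k ≤ K) (hn3 : 3 ≤ F.L ^ k) (ψ : PBond (F.P K) 0 → PBond (F.P K) k → Matrix n n ℂ →ₗ[ℝ] Matrix n n ℂ)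
    (hψ : ∀ b c X, ‖ψ b c X‖ ≤ ‖X‖) (u : PBond (F.P K) k → Matrix n n ℂ) : ‖byEntryTw (obLiftL F K k) ψ u‖ ≤ 1056 / (F.L : ℝ) ^ k * ‖u‖ :=
  (pi_norm_le_iff_of_nonneg (by positivity)).2 fun b => norm_byEntryTw_obLiftL_le hk hn3 ψ hψ u (fun c => norm_le_pi_norm u c) b

/-- **★★ THE EXACTNESS DEFECT OF THE TWISTED ONE-BLOCK KERNEL — k-FREE**: for frames `θ`-close to the identity ON THE ONE-BLOCK SUPPORT (`‖ψ b c X − X‖ ≤ θ‖X‖` whenever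
`c₋ = coarsen k b₋`) and data `‖u c‖ ≤ M`: `‖linAvgIterM k (byEntryTw obLiftL ψ u) c − u c‖ ≤ 4224·(θ·M)` (`= (d+1)L^k · (1056∕L^k) · θ · M`).
[cite: Balaban1987RG1, (0.4)+(0.11) p.253; Balaban1985Averaging, (11) p.19] -/
theorem norm_linAvgIterM_byEntryTw_obLiftL_sub_le [Nonempty n] (hk : k ≤ K) (hn3 : 3 ≤ F.L ^ k)
    (ψ : PBond (F.P K) 0 → PBond (F.P K) k → Matrix n n ℂ →ₗ[ℝ] Matrix n n ℂ) {θ : ℝ} (hθ : 0 ≤ θ)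
    (hψ : ∀ (b : PBond (F.P K) 0) (c : PBond (F.P K) k) (X : Matrix n n ℂ), c.src = coarsen k b.src → ‖ψ b c X - X‖ ≤ θ * ‖X‖)
    (u : PBond (F.P K) k → Matrix n n ℂ) {M : ℝ} (hu : ∀ c, ‖u c‖ ≤ M) (c : PBond (F.P K) k) :
    ‖linAvgIterM k (byEntryTw (obLiftL F K k) ψ u) c - u c‖ ≤ 4224 * (θ * M) := by
  have h : ‖linAvgIterM k (byEntryTw (obLiftL F K k) ψ u) c - u c‖ ≤ ((((3 : ℕ) : ℝ) + 1) * (F.L : ℝ) ^ k) * (1056 / (F.L : ℝ) ^ k * (θ * M)) :=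
    norm_linAvgIterM_byEntryTw_sub_le_of_exact k (obLiftL F K k) (fun (b : PBond (F.P K) 0) (c : PBond (F.P K) k) => c.src = coarsen k b.src)
      (obLiftL_rowB_local hk hn3) (obLiftL_rowE hk hn3) ψ hθ hψ u hu c
  refine h.trans (le_of_eq ?_)
  have hL : (0 : ℝ) < (F.L : ℝ) ^ k := by have := F.hL.2; positivity
  field_simp
  ring

/-- The same in the abstract kernel port's shape `((d+1)L^k)·(ρ·(θ·M))` (for consumers typed against `…LinearLiftMatrixKernel` ∕ `…NewtonLiftTwistedKernel`).
[cite: Balaban1987RG1, (0.4)+(0.11) p.253] -/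
theorem norm_linAvgIterM_byEntryTw_obLiftL_sub_le' [Nonempty n] (hk : k ≤ K) (hn3 : 3 ≤ F.L ^ k)
    (ψ : PBond (F.P K) 0 → PBond (F.P K) k → Matrix n n ℂ →ₗ[ℝ] Matrix n n ℂ) {θ : ℝ} (hθ : 0 ≤ θ)
    (hψ : ∀ (b : PBond (F.P K) 0) (c : PBond (F.P K) k) (X : Matrix n n ℂ), c.src = coarsen k b.src → ‖ψ b c X - X‖ ≤ θ * ‖X‖)
    (u : PBond (F.P K) k → Matrix n n ℂ) {M : ℝ} (hu : ∀ c, ‖u c‖ ≤ M) (c : PBond (F.P K) k) :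
    ‖linAvgIterM k (byEntryTw (obLiftL F K k) ψ u) c - u c‖ ≤ ((((F.P K).d : ℝ) + 1) * ((F.P K).L : ℝ) ^ k) * (1056 / (F.L : ℝ) ^ k * (θ * M)) :=
  norm_linAvgIterM_byEntryTw_sub_le_of_exact k (obLiftL F K k) (fun (b : PBond (F.P K) 0) (c : PBond (F.P K) k) => c.src = coarsen k b.src)
    (obLiftL_rowB_local hk hn3) (obLiftL_rowE hk hn3) ψ hθ hψ u hu c

/-- **★★ THE (r1-curl) ROW OF THE TWISTED ONE-BLOCK KERNEL**: for CONTRACTIVE frames frozen to within `θ′` between the base bond `b₁ = (x, μ)` and each of the other three bonds of the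
plaquette ON THAT BOND'S ONE-BLOCK SUPPORT, and data `‖u c‖ ≤ M`: `‖curlM (byEntryTw obLiftL ψ u) x μ ν‖ ≤ (1728∕L^{2k})·M + 3·((1056∕L^k)·(θ′·M))` (`μ ≠ ν`).
[cite: Balaban1985Averaging, (9)+(11) p.19; Balaban1985Variational, (8) p.279; Balaban1987RG1, (0.4)+(0.11) p.253] -/
theorem norm_curlM_byEntryTw_obLiftL_le (hk : k ≤ K) (hn3 : 3 ≤ F.L ^ k) (ψ : PBond (F.P K) 0 → PBond (F.P K) k → Matrix n n ℂ →ₗ[ℝ] Matrix n n ℂ)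
    (hψc : ∀ b c X, ‖ψ b c X‖ ≤ ‖X‖) (u : PBond (F.P K) k → Matrix n n ℂ) {M : ℝ} (hu : ∀ c, ‖u c‖ ≤ M) (x : Site (F.P K) 0) {μ ν : Fin 3} (hμν : μ ≠ ν)
    {θ' : ℝ} (hθ' : 0 ≤ θ')
    (hψ₂ : ∀ (c : PBond (F.P K) k) (X : Matrix n n ℂ), c.src = coarsen k (x.shift μ) → ‖ψ ⟨x.shift μ, ν⟩ c X - ψ ⟨x, μ⟩ c X‖ ≤ θ' * ‖X‖)
    (hψ₃ : ∀ (c : PBond (F.P K) k) (X : Matrix n n ℂ), c.src = coarsen k (x.shift ν) → ‖ψ ⟨x.shift ν, μ⟩ c X - ψ ⟨x, μ⟩ c X‖ ≤ θ' * ‖X‖)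
    (hψ₄ : ∀ (c : PBond (F.P K) k) (X : Matrix n n ℂ), c.src = coarsen k x → ‖ψ ⟨x, ν⟩ c X - ψ ⟨x, μ⟩ c X‖ ≤ θ' * ‖X‖) :
    ‖curlM (byEntryTw (obLiftL F K k) ψ u) x μ ν‖ ≤ 1728 / ((F.L : ℝ) ^ k) ^ 2 * M + 3 * (1056 / (F.L : ℝ) ^ k * (θ' * M)) :=
  norm_curlM_byEntryTw_le k (obLiftL F K k) (fun (b : PBond (F.P K) 0) (c : PBond (F.P K) k) => c.src = coarsen k b.src) (obLiftL_rowB_local hk hn3)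
    (fun c : PBond (F.P K) k => c.src = coarsen k x ∨ c.src = coarsen k (x.shift μ) ∨ c.src = coarsen k (x.shift ν)) x
    (fun f M' hf => obLiftL_rowC_local hk hn3 f M' x μ ν hμν hf) ψ hψc u hu hθ' (fun c X hc => hψ₂ c X hc) (fun c X hc => hψ₃ c X hc) (fun c X hc => hψ₄ c X hc)

end Twist

end Summit.QuantumFields.YangMills.Theorems.OneBlockLiftMatrix

end
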